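import Mathlib.FieldTheory.Galois.Infinite
import Mathlib.FieldTheory.KrullTopology
import Mathlib.Topology.Algebra.Group.ClosedSubgroup
import Mathlib.Topology.Algebra.OpenSubgroup
import Mathlib.RingTheory.RamificationInertia.Inertia
import Mathlib.NumberTheory.RamificationInertia.Inertia
import Mathlib.NumberTheory.RamificationInertia.Galois
import Mathlib.RingTheory.DedekindDomain.Different
import Mathlib.RingTheory.DedekindDomain.Factorization
import Mathlib.RingTheory.Ideal.Quotient.HasFiniteQuotients
import Mathlib.RingTheory.Flat.TorsionFree
import Literature.NumberTheory.GaloisRepresentations.AbsGaloisGroup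
import Literature.NumberTheory.GaloisRepresentations.GaloisRep
import Literature.NumberTheory.GaloisRepresentations.GaloisRepFrobeniusProofs
import Literature.NumberTheory.GaloisRepresentations.IntegralGaloisActionProofs
import Literature.NumberTheory.GaloisRepresentations.ProjectiveType
import Literature.NumberTheory.GaloisRepresentations.ProjectiveTypeSolvable
import Literature.NumberTheory.EllipticCurves.KummerUnramified
import HarnessLib

/-!
# Restriction of Artin representations to open subgroups: cut-out fields, projective images,
Frobenius elements and unramifiedness (trunk GalRep)

Topic `NumberTheory/GaloisRepresentations`. This file supplies the **Galois-theoretic glue** used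
in the global part of Tunnell's proof of the octahedral case of the strong Artin conjecture
(Tunnell, *Artin's conjecture for representations of octahedral type*, Bull. AMS 5 (1981),
p. 174: "Let `E/F` be the quadratic subextension of `L/F` fixed by all elements of `Gal(L/F)`
mapping to the unique index two subgroup of the octahedral group `S_4`. Choose a 2-Sylow subgroup
of the octahedral group and let `K/F` be the cubic subextension fixed by all elements of
`Gal(L/F)` mapping to this chosen Sylow subgroup … For any subextension `T/F` of `L/F`, let `ρ_T`
be the restriction of `ρ` to `Gal(L/T)`"), for the tree's carriers: the absolute Galois group
`Γ_F = Field.absoluteGaloisGroup F`, framed continuous representations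
`σ : Γ_F →ₜ* GL_n(A)` (`Literature.NumberTheory.GaloisRepresentations.FramedGaloisRep`), their restriction `σ|_{Γ_E}`
(`FramedGaloisRep.restrictField`, along `Literature.absGaloisRestrict F E : Γ_E →ₜ* Γ_F`, a chosen
`F̄ ≅ Ē`), the projective image `\bar σ(Γ_F) ≤ PGL_n` and Klein types (`ProjectiveType`), primes of
`\bar ℤ_F`, inertia and arithmetic Frobenius (`IntegralGaloisAction`, `GaloisRep`).
**Everything here is proved**; there is no new definition and no named fact.

## Main results

* `Literature.NumberTheory.GaloisRepresentations.exists_intermediateField_projectiveImage_restrictField` — **cutting out a subextension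
  by a subgroup of the projective image**: for `σ` with open kernel and `Q ≤ \bar σ(Γ_F)`, the
  fixed field `L = F̄^H`, `H = \bar σ⁻¹(Q)`, is finite over `F` of degree `[\bar σ(Γ_F) : Q]` and
  `\bar{σ|_{Γ_L}}(Γ_L) ≅ Q` (via `exists_mem_range_absGaloisRestrict_iff`: the image of
  `Γ_E → Γ_F` is `Gal(F̄/e(E))` for an `F`-embedding `e : E → F̄`;
  `exists_mem_range_absGaloisRestrict_fixedField_iff`: for `E = F̄^H` it is a conjugate of `H`;
  `projectiveImage_comp_eq_conj_smul`).
* `Literature.NumberTheory.GaloisRepresentations.exists_subgroup_mulEquiv_alternatingGroup_of_mulEquiv_perm`,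
  `Literature.NumberTheory.GaloisRepresentations.exists_subgroup_mulEquiv_dihedralGroup_of_mulEquiv_perm` — in `P ≅ S_4`: a subgroup of
  index `2` (order `12`) isomorphic to `A_4`, and one of index `3` (order `8`) isomorphic to `D_4`
  (explicit `D_4 ↪ S_4`, checked by `decide`).
* `Literature.NumberTheory.GaloisRepresentations.isIrreducible_of_not_isCyclicType` — over a field of characteristic `0`, a representation
  `G → GL_2(k)` with finite image and **non-cyclic** projective image is irreducible (a common
  eigenvector forces cyclic projective image, `isCyclicType_of_hasCommonEigenvector`, through the
  character `χ₁²/det` and `GL2.coe_eq_smul_one_of_mulVec_eq_smul`); with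
  `IsTetrahedralType.not_isCyclicType`, `not_isCyclicType_of_mulEquiv_dihedralGroup_four`.
* `Literature.NumberTheory.GaloisRepresentations.exists_primesAbove_restrict` — **primes, inertia and Frobenius under `Γ_E → Γ_F`**: for
  `w ∣ v` and `𝔔 ∣ w` a prime of `\bar ℤ_E`, the prime `𝔓 = ι⁻¹(𝔔) ∣ v` of `\bar ℤ_F` has
  `res(I_𝔔) ≤ I_𝔓` and `res(Frob_𝔔) ≡ Frob_𝔓^{f(w|v)} (mod I_𝔓)` (`N w = (N v)^{f(w|v)}`); hence
  `FramedGaloisRep.isUnramifiedAt_restrictField`, `FramedGaloisRep.exists_restrictField_apply_eq_pow`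
  and, in rank `2`, `FramedGaloisRep.hasFrobCharpolyAt_restrictField_fin_two`:
  `charpoly σ(Frob_v) = (X - a)(X - b) ⟹ charpoly σ|_{Γ_E}(Frob_w) = (X - a^f)(X - b^f)`
  (`Matrix.charpoly_pow_eq_of_charpoly_eq_fin_two`, Newton's recursion from Cayley–Hamilton) — the
  Galois side of the base-change relation `t_{Π_w} = t_{π_v}^{f(w|v)}`.
* `Literature.NumberTheory.GaloisRepresentations.FramedGaloisRep.eventually_isUnramifiedAt_of_isOpen_ker` — **a Galois representation with
  open kernel (e.g. an Artin representation, `isOpen_ker_of_finite_range`) is unramified at all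
  but finitely many places**: with `L = F̄^{ker σ}` finite Galois over `F`, at `v` below no prime
  factor of the different `𝔇_{L/F}` one has `e = 1`, the inertia group in `Gal(L/F)` is trivial
  (Mathlib `Ideal.card_inertia_eq_ramificationIdxIn`), so `I_𝔓 ≤ Gal(F̄/L) = ker σ`.

## Mathlib / tree reuse

Infinite Galois theory (`InfiniteGalois.fixingSubgroup_fixedField`, `isOpen_iff_finite`,
`normal_iff_isGalois`, `IntermediateField.finrank_eq_fixingSubgroup_index`,
`AlgHom.liftNormal`, `AlgEquiv.restrictNormalHom`), `IsArithFrobAt`, `Ideal.inertia`,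
`Ideal.inertiaDeg`, `Ideal.absNorm_eq_pow_inertiaDeg'_of_liesOver`, `pow_sub_one_dvd_differentIdeal`,
`differentIdeal_ne_bot`, `Ideal.finite_factors`, `Ideal.ramificationIdxIn_eq_ramificationIdx`,
`Matrix.charpoly_fin_two`, `isCyclic_of_surjective`, `Subgroup.isOpen_of_isClosed_of_finiteIndex`;
from the tree: `absGaloisRestrict_apply_smul` (`AbsGaloisGroup`),
`exists_isArithFrobAt_of_mem_primesAbove_holds` (`IntegralGaloisActionProofs`),
`GL2.cayley_hamilton_two`, `GL2.sub_mul_sub_eq_zero`, `GL2.smul_one_add_pow_of_mul_self_eq_zero`,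
`GL2.mem_center_iff`, `projectiveImage_range_subtype`, `HasCommonEigenvector`
(`ProjectiveTypeSolvable`), `ringOfIntegersToIntegralClosure` (`EllipticCurves/KummerUnramified`).
No Mathlib declaration is duplicated (`lean search` for `range_absGaloisRestrict`,
`charpoly_pow`, `isUnramifiedAt_restrict`, `eventually_isUnramifiedAt`: nothing).

## References

* J. Tunnell, *Artin's conjecture for representations of octahedral type*, Bull. AMS (N.S.) 5
  (1981), 173–175, p. 174 (the fields `E`, `K`, `M` and the restrictions `ρ_T`). [Tunnell1981]
* J.-P. Serre, *Abelian ℓ-adic representations and elliptic curves* (1968), Ch. I §2.1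
  (unramified places, Frobenius, Artin representations unramified outside a finite set).
  [SerreAbelianLadic1968]
* J. Neukirch, *Algebraic Number Theory* (1999), Ch. I §9 ((9.1), (9.4)–(9.5): transitivity,
  Frobenius in extensions), Ch. III §2 (the different and ramification), Ch. IV §1 (Krull
  topology, infinite Galois correspondence). [NeukirchANT1999]
* J. S. Milne, *Fields and Galois Theory*, §7 (restriction maps between absolute Galois groups).
  [MilneFT2022]
-/

noncomputable section

open Field IntermediateField
open scoped Pointwise

namespace Literature.NumberTheory.GaloisRepresentations

/-! ### Open subgroups of `Γ_F` and their fixed fields -/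

section OpenSubgroups

variable {F : Type*} [Field F]

/-- For an open subgroup `H ≤ Γ_F = Gal(F̄/F)` (char. `0`, so `F̄/F` is Galois), the fixed field
`L = F̄^H` is a finite extension of `F` with `Gal(F̄/L) = H` and `[L : F] = [Γ_F : H]`
(Krull's Galois correspondence for open = closed-of-finite-index subgroups).
Ref: Neukirch, *Algebraic Number Theory*, Ch. IV §1, Thm. (1.2). [folklore] -/
theorem fixingSubgroup_fixedField_of_isOpen [CharZero F] (H : Subgroup (absoluteGaloisGroup F))
    (hH : IsOpen (H : Set (absoluteGaloisGroup F))) :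
    (IntermediateField.fixedField H :
      IntermediateField F (AlgebraicClosure F)).fixingSubgroup = H :=
  InfiniteGalois.fixingSubgroup_fixedField ⟨H, H.isClosed_of_isOpen hH⟩

/-- The fixed field of an open subgroup of `Γ_F` is a finite extension of `F`
(Krull topology: open fixing subgroups ↔ finite subextensions).
Ref: Neukirch, *Algebraic Number Theory*, Ch. IV §1. [folklore] -/
theorem finiteDimensional_fixedField_of_isOpen [CharZero F] (H : Subgroup (absoluteGaloisGroup F))
    (hH : IsOpen (H : Set (absoluteGaloisGroup F))) :
    FiniteDimensional F (IntermediateField.fixedField H :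
      IntermediateField F (AlgebraicClosure F)) := by
  rw [← InfiniteGalois.isOpen_iff_finite, fixingSubgroup_fixedField_of_isOpen H hH]
  exact hH

/-- The degree of the fixed field of an open subgroup `H ≤ Γ_F` is the index `[Γ_F : H]`.
Ref: Neukirch, *Algebraic Number Theory*, Ch. IV §1. [folklore] -/
theorem finrank_fixedField_of_isOpen [CharZero F] (H : Subgroup (absoluteGaloisGroup F))
    (hH : IsOpen (H : Set (absoluteGaloisGroup F))) :
    Module.finrank F (IntermediateField.fixedField H :
      IntermediateField F (AlgebraicClosure F)) = H.index := by
  rw [IntermediateField.finrank_eq_fixingSubgroup_index, fixingSubgroup_fixedField_of_isOpen H hH]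
  rfl

/-- Membership in the fixing subgroup `Gal(F̄/L) ≤ Γ_F` of a subfield `L ⊆ F̄`, in terms of the
action of `Γ_F` on `F̄`. [folklore] -/
theorem mem_fixingSubgroup_iff_forall_smul (L : IntermediateField F (AlgebraicClosure F))
    (γ : absoluteGaloisGroup F) :
    γ ∈ (L.fixingSubgroup : Subgroup (absoluteGaloisGroup F)) ↔
      ∀ x : L, γ • (x : AlgebraicClosure F) = x := by
  change (absoluteGaloisGroup.toAlgEquiv F γ) ∈ L.fixingSubgroup ↔ _
  rw [IntermediateField.mem_fixingSubgroup_iff]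
  exact ⟨fun h x => h x x.2, fun h x hx => h ⟨x, hx⟩⟩

end OpenSubgroups

/-! ### Embeddings of subfields of `F̄` extend to `Γ_F` -/

section Embeddings

variable {F : Type*} [Field F]

/-- Every `F`-embedding `e : L → F̄` of a subfield `F ⊆ L ⊆ F̄` is the restriction of an element
of `Γ_F` (extension of embeddings to the normal extension `F̄/F`). [folklore] -/
theorem exists_absoluteGaloisGroup_smul_eq (L : IntermediateField F (AlgebraicClosure F))
    (e : L →ₐ[F] AlgebraicClosure F) :
    ∃ g : absoluteGaloisGroup F, ∀ x : L, g • (x : AlgebraicClosure F) = e x := by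
  let φ : AlgebraicClosure F →ₐ[F] AlgebraicClosure F := e.liftNormal (AlgebraicClosure F)
  let g : AlgebraicClosure F ≃ₐ[F] AlgebraicClosure F :=
    AlgEquiv.ofBijective φ (AlgHom.normal_bijective F _ _ φ)
  refine ⟨(absoluteGaloisGroup.toAlgEquiv F).symm g, fun x => ?_⟩
  rw [absoluteGaloisGroup.toAlgEquiv_symm_apply]
  change φ (algebraMap L (AlgebraicClosure F) x) = e x
  rw [AlgHom.liftNormal_commutes]
  rfl

/-- The elements of `Γ_F` fixing `e(L)` pointwise form the conjugate `g · Gal(F̄/L) · g⁻¹` of the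
fixing subgroup of `L`, where `g ∈ Γ_F` extends `e`. [folklore] -/
theorem forall_smul_eq_iff_mem_conj (L : IntermediateField F (AlgebraicClosure F))
    (e : L →ₐ[F] AlgebraicClosure F) {g : absoluteGaloisGroup F}
    (hg : ∀ x : L, g • (x : AlgebraicClosure F) = e x) (γ : absoluteGaloisGroup F) :
    (∀ x : L, γ • e x = e x) ↔ ∀ x : L, (g⁻¹ * γ * g) • (x : AlgebraicClosure F) = x := by
  refine forall_congr' fun x => ?_
  rw [← hg x, mul_smul, mul_smul, inv_smul_eq_iff]

end Embeddings

/-! ### The image of `Γ_E → Γ_F` is the Galois group of a copy of `E` inside `F̄` -/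

section RangeRestrict

variable (F E : Type*) [Field F] [Field E] [Algebra F E] [Algebra.IsAlgebraic F E]

attribute [local instance] absClosureAlgebra absClosure_isScalarTower in
/-- **The image of the restriction map `Γ_E → Γ_F`** for an algebraic extension `E/F`: there is an
`F`-embedding `e : E → F̄` (namely `ι⁻¹ ∘ (E → Ē)` for the chosen isomorphism `ι : F̄ → Ē`) such
that `res(Γ_E) = Gal(F̄/e(E))`, the subgroup of `Γ_F` fixing `e(E)` pointwise.
Ref: Milne, *Fields and Galois Theory*, §7 (restriction to a subfield); Neukirch, *Algebraic
Number Theory*, Ch. IV §1. [folklore] -/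
theorem exists_mem_range_absGaloisRestrict_iff :
    ∃ e : E →ₐ[F] AlgebraicClosure F, ∀ g : absoluteGaloisGroup F,
      g ∈ (absGaloisRestrict F E).range ↔ ∀ x : E, g • e x = e x := by
  haveI : Algebra.IsAlgebraic (AlgebraicClosure F) (AlgebraicClosure E) :=
    Algebra.IsAlgebraic.tower_top (K := F) (AlgebraicClosure F)
  have hbij : Function.Bijective (absClosureEmbedding F E) :=
    IsAlgClosed.algebraMap_bijective_of_isIntegral (k := AlgebraicClosure F)
      (K := AlgebraicClosure E)
  let ιe : AlgebraicClosure F ≃ₐ[F] AlgebraicClosure E :=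
    AlgEquiv.ofBijective (absClosureEmbedding F E) hbij
  have hιe : ∀ y, ιe y = absClosureEmbedding F E y := fun _ => rfl
  let e : E →ₐ[F] AlgebraicClosure F :=
    ιe.symm.toAlgHom.comp (IsScalarTower.toAlgHom F E (AlgebraicClosure E))
  have he : ∀ x : E, absClosureEmbedding F E (e x) = algebraMap E (AlgebraicClosure E) x :=
    fun x => by
      change ιe (ιe.symm (algebraMap E (AlgebraicClosure E) x)) = _
      exact ιe.apply_symm_apply _
  refine ⟨e, fun g => ⟨?_, fun hg => ?_⟩⟩
  · rintro ⟨τ, rfl⟩ x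
    apply hbij.1
    change absClosureEmbedding F E (absGaloisRestrict F E τ • e x) = _
    rw [absGaloisRestrict_apply_smul, he, absoluteGaloisGroup.smul_def, AlgEquiv.commutes]
  · -- build `τ ∈ Γ_E` with `res τ = g`
    let r : AlgebraicClosure E ≃+* AlgebraicClosure E :=
      ιe.symm.toRingEquiv.trans
        (((absoluteGaloisGroup.toAlgEquiv F g).toRingEquiv).trans ιe.toRingEquiv)
    have hr : ∀ y, r y = ιe (g • ιe.symm y) := fun _ => rfl
    have hcomm : ∀ x : E, r (algebraMap E (AlgebraicClosure E) x) =
        algebraMap E (AlgebraicClosure E) x := fun x => by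
      rw [hr]
      change ιe (g • e x) = _
      rw [hg x, hιe, he]
    let τ' : AlgebraicClosure E ≃ₐ[E] AlgebraicClosure E := AlgEquiv.ofRingEquiv (f := r) hcomm
    refine ⟨(absoluteGaloisGroup.toAlgEquiv E).symm τ', ?_⟩
    apply FaithfulSMul.eq_of_smul_eq_smul (α := AlgebraicClosure F)
    intro y
    apply hbij.1
    change absClosureEmbedding F E (absGaloisRestrict F E _ • y) = _
    rw [absGaloisRestrict_apply_smul, absoluteGaloisGroup.toAlgEquiv_symm_apply]
    change r (absClosureEmbedding F E y) = _
    rw [hr, ← hιe, ιe.symm_apply_apply, hιe]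

end RangeRestrict

/-! ### Restriction to the fixed field of an open subgroup -/

section FixedFieldRestrict

variable {F : Type*} [Field F] [CharZero F]

/-- **`Γ_L` inside `Γ_F` for `L = F̄^H`.** For an open subgroup `H ≤ Γ_F` with fixed field
`L = F̄^H ⊆ F̄`, the image of the restriction map `Γ_L = Gal(L̄/L) → Γ_F` (defined through a
chosen `F`-isomorphism `F̄ ≅ L̄`, `Literature.NumberTheory.GaloisRepresentations.absGaloisRestrict`) is a conjugate `g H g⁻¹` of `H`
(it is `Gal(F̄/e(L))` for the induced embedding `e : L → F̄`, and `e = g|_L`).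
Ref: Neukirch, *Algebraic Number Theory*, Ch. IV §1; Milne, *Fields and Galois Theory*, §7. [folklore] -/
theorem exists_mem_range_absGaloisRestrict_fixedField_iff (H : Subgroup (absoluteGaloisGroup F))
    (hH : IsOpen (H : Set (absoluteGaloisGroup F))) :
    ∃ g : absoluteGaloisGroup F, ∀ γ : absoluteGaloisGroup F,
      γ ∈ (absGaloisRestrict F (IntermediateField.fixedField H :
        IntermediateField F (AlgebraicClosure F))).range ↔ g⁻¹ * γ * g ∈ H := by
  set L : IntermediateField F (AlgebraicClosure F) := IntermediateField.fixedField H with hL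
  haveI : FiniteDimensional F L := finiteDimensional_fixedField_of_isOpen H hH
  obtain ⟨e, he⟩ := exists_mem_range_absGaloisRestrict_iff F L
  obtain ⟨g, hg⟩ := exists_absoluteGaloisGroup_smul_eq L e
  refine ⟨g, fun γ => ?_⟩
  rw [he γ, forall_smul_eq_iff_mem_conj L e hg γ, ← mem_fixingSubgroup_iff_forall_smul,
    fixingSubgroup_fixedField_of_isOpen H hH]
  exact Iff.rfl

end FixedFieldRestrict

/-! ### Projective image of a restriction -/

section ProjectiveImageComp

open scoped MatrixGroups

variable {G G' : Type*} [Group G] [Group G'] {n : Type*} [Fintype n] [DecidableEq n]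
  {R : Type*} [CommRing R]

/-- **Projective image of a restriction.** Let `ρ : G → GL_n(R)` with projective image
`\bar ρ(G)`, `Q ≤ \bar ρ(G)` a subgroup and `H = \bar ρ⁻¹(Q) ≤ G`. If `r : G' → G` has image a
conjugate `g H g⁻¹`, then the projective image of `ρ ∘ r` is the conjugate
`\bar ρ(g) Q \bar ρ(g)⁻¹` of `Q` (as subgroups of `PGL_n(R)`). [folklore] -/
theorem projectiveImage_comp_eq_conj_smul (ρ : G →* GL n R) (r : G' →* G)
    (Q : Subgroup (projectiveImage ρ)) (g : G)
    (hr : ∀ γ : G, γ ∈ r.range ↔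
      g⁻¹ * γ * g ∈ (Q.map (projectiveImage ρ).subtype).comap
        (Matrix.ProjGenLinGroup.mk.comp ρ)) :
    projectiveImage (ρ.comp r) =
      MulAut.conj (Matrix.ProjGenLinGroup.mk (ρ g)) • Q.map (projectiveImage ρ).subtype := by
  set c : PGL(n, R) := Matrix.ProjGenLinGroup.mk (ρ g) with hc
  ext x
  rw [Subgroup.mem_pointwise_smul_iff_inv_smul_mem, mem_projectiveImage, MulAut.smul_def,
    MulAut.conj_inv_apply]
  constructor
  · rintro ⟨t, rfl⟩
    have ht : g⁻¹ * r t * g ∈ (Q.map (projectiveImage ρ).subtype).comap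
        (Matrix.ProjGenLinGroup.mk.comp ρ) := (hr (r t)).mp ⟨t, rfl⟩
    rw [Subgroup.mem_comap] at ht
    simpa [map_mul, map_inv, mul_assoc] using ht
  · intro hx
    obtain ⟨⟨y, hyQ⟩, hyQ', hy⟩ := Subgroup.mem_map.mp hx
    obtain ⟨u, hu⟩ := (mem_projectiveImage).mp hyQ
    have hmem : g * u * g⁻¹ ∈ r.range := by
      rw [hr, show g⁻¹ * (g * u * g⁻¹) * g = u by group, Subgroup.mem_comap]
      exact Subgroup.mem_map.mpr ⟨⟨y, hyQ⟩, hyQ', by simpa using hu.symm⟩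
    obtain ⟨t, ht⟩ := hmem
    refine ⟨t, ?_⟩
    have hy' : y = c⁻¹ * x * c := hy
    change Matrix.ProjGenLinGroup.mk (ρ (r t)) = x
    rw [ht, map_mul, map_mul, map_inv, map_mul, map_mul, map_inv, hu, hy', ← hc]
    group

/-- Under the hypotheses of `projectiveImage_comp_eq_conj_smul`, the projective image of
`ρ ∘ r` is isomorphic to `Q`. [folklore] -/
theorem nonempty_projectiveImage_comp_mulEquiv (ρ : G →* GL n R) (r : G' →* G)
    (Q : Subgroup (projectiveImage ρ)) (g : G)
    (hr : ∀ γ : G, γ ∈ r.range ↔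
      g⁻¹ * γ * g ∈ (Q.map (projectiveImage ρ).subtype).comap
        (Matrix.ProjGenLinGroup.mk.comp ρ)) :
    Nonempty (projectiveImage (ρ.comp r) ≃* Q) := by
  rw [projectiveImage_comp_eq_conj_smul ρ r Q g hr]
  exact ⟨(Subgroup.equivSMul _ _).symm.trans
    (Q.equivMapOfInjective _ (Subgroup.subtype_injective _)).symm⟩

/-- The preimage `H = \bar ρ⁻¹(Q)` has the index of `Q` in the projective image. [folklore] -/
theorem index_comap_projectiveImage (ρ : G →* GL n R) (Q : Subgroup (projectiveImage ρ)) :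
    ((Q.map (projectiveImage ρ).subtype).comap (Matrix.ProjGenLinGroup.mk.comp ρ)).index =
      Q.index := by
  have h1 : (Q.map (projectiveImage ρ).subtype).comap (Matrix.ProjGenLinGroup.mk.comp ρ) =
      Q.comap (Matrix.ProjGenLinGroup.mk.comp ρ).rangeRestrict := by
    ext γ
    simp only [Subgroup.mem_comap, Subgroup.mem_map, Subgroup.coe_subtype, MonoidHom.coe_comp,
      Function.comp_apply]
    constructor
    · rintro ⟨q, hq, hq'⟩
      have hq'' : (Matrix.ProjGenLinGroup.mk.comp ρ).rangeRestrict γ = q := by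
        ext
        rw [MonoidHom.coe_rangeRestrict]
        simpa using hq'.symm
      rwa [hq'']
    · intro h
      exact ⟨_, h, rfl⟩
  rw [h1]
  exact Subgroup.index_comap_of_surjective _ (MonoidHom.rangeRestrict_surjective _)

end ProjectiveImageComp

end Literature.NumberTheory.GaloisRepresentations

namespace Literature.NumberTheory.GaloisRepresentations

/-! ### Cutting out subfields by subgroups of the projective image -/

section CutOut

open scoped MatrixGroups

variable {F : Type*} [Field F] [CharZero F] {A : Type*} [CommRing A] [TopologicalSpace A]
  {n : ℕ}

omit [CharZero F] in
/-- A continuous representation `σ : Γ_F → GL_n(A)` with finite image has open kernel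
(the kernel is closed of finite index). Serre, *Abelian ℓ-adic representations* (1968), Ch. I
§1.1. [folklore] -/
theorem isOpen_ker_of_finite_range [T1Space (GL (Fin n) A)] (σ : FramedGaloisRep F A n)
    [Finite σ.toMonoidHom.range] : IsOpen (σ.toMonoidHom.ker : Set (absoluteGaloisGroup F)) := by
  have hclosed : IsClosed (σ.toMonoidHom.ker : Set (absoluteGaloisGroup F)) := by
    have : (σ.toMonoidHom.ker : Set (absoluteGaloisGroup F)) = σ ⁻¹' {1} := by
      ext; simp [MonoidHom.mem_ker]
    rw [this]
    exact (isClosed_singleton).preimage σ.continuous_toFun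
  haveI : Finite (absoluteGaloisGroup F ⧸ σ.toMonoidHom.ker) :=
    Finite.of_equiv _ (QuotientGroup.quotientKerEquivRange σ.toMonoidHom).symm.toEquiv
  haveI : σ.toMonoidHom.ker.FiniteIndex := Subgroup.finiteIndex_of_finite_quotient
  exact Subgroup.isOpen_of_isClosed_of_finiteIndex _ hclosed

omit [CharZero F] in
/-- The preimage in `Γ_F` of a subgroup `Q` of the projective image of `σ` is open when `σ` has
open kernel. [folklore] -/
theorem isOpen_comap_projectiveImage (σ : FramedGaloisRep F A n)
    (hker : IsOpen (σ.toMonoidHom.ker : Set (absoluteGaloisGroup F)))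
    (Q : Subgroup (projectiveImage σ.toMonoidHom)) :
    IsOpen (((Q.map (projectiveImage σ.toMonoidHom).subtype).comap
      (Matrix.ProjGenLinGroup.mk.comp σ.toMonoidHom) : Subgroup (absoluteGaloisGroup F)) :
        Set (absoluteGaloisGroup F)) := by
  refine Subgroup.isOpen_mono ?_ hker
  intro γ hγ
  rw [MonoidHom.mem_ker] at hγ
  rw [Subgroup.mem_comap, MonoidHom.comp_apply, hγ, map_one]
  exact one_mem _

/-- **Cutting out a subextension by a subgroup of the projective image.** Let
`σ : Γ_F → GL_n(A)` be continuous with open kernel (e.g. an Artin representation) and `Q` a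
subgroup of its projective image `\bar σ(Γ_F) ≤ PGL_n(A)`. The fixed field `L = F̄^H ⊆ F̄` of
`H = \bar σ⁻¹(Q)` is a finite extension of `F` of degree `[\bar σ(Γ_F) : Q]`, and the projective
image of the restriction `σ|_{Γ_L}` (`FramedGaloisRep.restrictField`, through the chosen
`F̄ ≅ L̄`) is isomorphic to `Q` (it is a conjugate of `Q` in `\bar σ(Γ_F)`). This is the
construction "let `E/F` be the subextension fixed by all elements of `Gal(L/F)` mapping to the
subgroup … of `S_4`" of Tunnell, Bull. AMS 5 (1981), p. 174. [folklore] -/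
theorem exists_intermediateField_projectiveImage_restrictField (σ : FramedGaloisRep F A n)
    (hker : IsOpen (σ.toMonoidHom.ker : Set (absoluteGaloisGroup F)))
    (Q : Subgroup (projectiveImage σ.toMonoidHom)) :
    ∃ L : IntermediateField F (AlgebraicClosure F), FiniteDimensional F L ∧
      Module.finrank F L = Q.index ∧
      Nonempty (projectiveImage (σ.restrictField L).toMonoidHom ≃* Q) := by
  set H : Subgroup (absoluteGaloisGroup F) :=
    (Q.map (projectiveImage σ.toMonoidHom).subtype).comap
      (Matrix.ProjGenLinGroup.mk.comp σ.toMonoidHom) with hHdef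
  have hH : IsOpen (H : Set (absoluteGaloisGroup F)) := isOpen_comap_projectiveImage σ hker Q
  refine ⟨IntermediateField.fixedField H, finiteDimensional_fixedField_of_isOpen H hH, ?_, ?_⟩
  · rw [finrank_fixedField_of_isOpen H hH, hHdef, index_comap_projectiveImage]
  · obtain ⟨g, hg⟩ := exists_mem_range_absGaloisRestrict_fixedField_iff H hH
    exact nonempty_projectiveImage_comp_mulEquiv σ.toMonoidHom
      (absGaloisRestrict F (IntermediateField.fixedField H)).toMonoidHom Q g hg

end CutOut

end Literature.NumberTheory.GaloisRepresentations

namespace Literature.NumberTheory.GaloisRepresentations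

/-! ### Subgroups of the octahedral group: `A_4` (index `2`) and a `2`-Sylow `D_4` (index `3`) -/

section OctahedralSubgroups

/-- **A dihedral subgroup of order `8` in `S_4`** (a `2`-Sylow subgroup: the symmetries of the
square with vertices `0, 1, 2, 3`, generated by the rotation `(0 1 2 3)` and the reflection
`(1 3)`); the homomorphism property and injectivity of the explicit map `D_4 → S_4` are checked
by `decide`. [folklore] -/
theorem exists_subgroup_perm_fin_four_mulEquiv_dihedralGroup :
    ∃ D : Subgroup (Equiv.Perm (Fin 4)), Nat.card D = 8 ∧ Nonempty (D ≃* DihedralGroup 4) := by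
  let f : DihedralGroup 4 → Equiv.Perm (Fin 4) := fun x => match x with
    | DihedralGroup.r i => (finRotate 4) ^ (i.val)
    | DihedralGroup.sr i => Equiv.swap 1 3 * (finRotate 4) ^ (i.val)
  have hmul : ∀ a b, f (a * b) = f a * f b := by decide
  let φ : DihedralGroup 4 →* Equiv.Perm (Fin 4) := MonoidHom.mk' f hmul
  have hinj : Function.Injective φ := by
    have h : ∀ a b, f a = f b → a = b := by decide
    exact fun a b hab => h a b hab
  refine ⟨φ.range, ?_, ⟨(MonoidHom.ofInjective hinj).symm⟩⟩
  rw [← Nat.card_congr (MonoidHom.ofInjective hinj).toEquiv, DihedralGroup.nat_card]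

variable {P : Type*} [Group P]

/-- In a group `P ≅ S_4` there is a subgroup of index `2` isomorphic to `A_4` (of order `12`).
[folklore] -/
theorem exists_subgroup_mulEquiv_alternatingGroup_of_mulEquiv_perm (e : P ≃* Equiv.Perm (Fin 4)) :
    ∃ Q : Subgroup P, Q.index = 2 ∧ Nat.card Q = 12 ∧
      Nonempty (Q ≃* alternatingGroup (Fin 4)) := by
  refine ⟨(alternatingGroup (Fin 4)).comap e.toMonoidHom, ?_, ?_, ?_⟩
  · rw [Subgroup.index_comap_of_surjective _ e.surjective, alternatingGroup.index_eq_two]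
  · rw [Subgroup.comap_equiv_eq_map_symm', Nat.card_congr
      ((alternatingGroup (Fin 4)).equivMapOfInjective _ e.symm.injective).symm.toEquiv]
    rw [nat_card_alternatingGroup, Nat.card_eq_fintype_card, Fintype.card_fin]
    rfl
  · rw [Subgroup.comap_equiv_eq_map_symm']
    exact ⟨((alternatingGroup (Fin 4)).equivMapOfInjective _ e.symm.injective).symm⟩

/-- In a group `P ≅ S_4` there is a subgroup of index `3` and order `8` isomorphic to the dihedral
group `D_4` (a `2`-Sylow subgroup). [folklore] -/
theorem exists_subgroup_mulEquiv_dihedralGroup_of_mulEquiv_perm (e : P ≃* Equiv.Perm (Fin 4)) :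
    ∃ Q : Subgroup P, Q.index = 3 ∧ Nat.card Q = 8 ∧ Nonempty (Q ≃* DihedralGroup 4) := by
  obtain ⟨D, hD, ⟨eD⟩⟩ := exists_subgroup_perm_fin_four_mulEquiv_dihedralGroup
  have hcard : Nat.card (D.comap e.toMonoidHom) = 8 := by
    rw [Subgroup.comap_equiv_eq_map_symm',
      Nat.card_congr (D.equivMapOfInjective _ e.symm.injective).symm.toEquiv, hD]
  refine ⟨D.comap e.toMonoidHom, ?_, hcard, ?_⟩
  · have h := (D.comap e.toMonoidHom).index_mul_card
    rw [hcard, Nat.card_congr e.toEquiv, Nat.card_perm, Nat.card_eq_fintype_card,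
      Fintype.card_fin] at h
    have h24 : Nat.factorial 4 = 24 := rfl
    omega
  · rw [Subgroup.comap_equiv_eq_map_symm']
    exact ⟨(D.equivMapOfInjective _ e.symm.injective).symm.trans eD⟩

end OctahedralSubgroups

end Literature.NumberTheory.GaloisRepresentations

namespace Literature.NumberTheory.GaloisRepresentations

/-! ### Non-cyclic projective image forces irreducibility (characteristic `0`) -/

section IrreducibleOfType

open Matrix

variable {G : Type*} [Group G] {k : Type*} [Field k]

local notation "M₂" => Matrix (Fin 2) (Fin 2) k

/-- An element of finite order of `GL_2(k)`, `char k = 0`, having an eigenvector `v` whose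
eigenvalue `l` satisfies `l² = det` (i.e. both eigenvalues equal `l`) is the scalar `l`:
its unipotent part `1 + l⁻¹ (a - l)` has finite order, hence is trivial. [folklore] -/
theorem GL2.coe_eq_smul_one_of_mulVec_eq_smul [CharZero k] {a : GL (Fin 2) k} {m : ℕ}
    (hm : 0 < m) (ham : a ^ m = 1) {v : Fin 2 → k} (hv : v ≠ 0) {l : k}
    (hav : (a : M₂) *ᵥ v = l • v) (hl : l * l = (a : M₂).det) : (a : M₂) = l • (1 : M₂) := by
  have hl0 : l ≠ 0 := by
    rintro rfl
    exact GL2.det_ne_zero a (by rw [← hl, zero_mul])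
  -- the trace is `2 l`: apply Cayley–Hamilton to `v`
  have htr : l + l = (a : M₂).trace := by
    have h1 : ((a : M₂) * (a : M₂)) *ᵥ v = (l * l) • v := by
      rw [← mulVec_mulVec, hav, mulVec_smul, hav, smul_smul]
    rw [GL2.cayley_hamilton_two, sub_mulVec, smul_mulVec, smul_mulVec, one_mulVec, hav,
      smul_smul, ← hl] at h1
    have h2 : ((a : M₂).trace * l - l * l - l * l) • v = 0 := by
      rw [sub_smul, sub_smul, h1, sub_self]
    rcases smul_eq_zero.mp h2 with h | h
    · have : l * ((a : M₂).trace - l - l) = 0 := by linear_combination h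
      rcases mul_eq_zero.mp this with h' | h'
      · exact absurd h' hl0
      · linear_combination -h'
    · exact absurd h hv
  set N : M₂ := (a : M₂) - l • (1 : M₂) with hN
  have hNN : N * N = 0 := GL2.sub_mul_sub_eq_zero (a : M₂) htr hl
  have haN : (a : M₂) = l • (1 : M₂) + N := by rw [hN]; abel
  have hpow : (l ^ m) • (1 : M₂) + ((m : k) * l ^ (m - 1)) • N = 1 := by
    rw [← GL2.smul_one_add_pow_of_mul_self_eq_zero N hNN l m, ← haN, ← Units.val_pow_eq_pow_val,
      ham, Units.val_one]
  -- multiply by `N`: `(1 - l ^ m) • N = 0`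
  have hkey : ((m : k) * l ^ (m - 1)) • N = (1 - l ^ m) • (1 : M₂) := by
    rw [sub_smul, one_smul]
    exact eq_sub_of_add_eq' hpow
  have hN0 : N = 0 := by
    have h3 : (1 - l ^ m) • N = 0 := by
      have := congrArg (· * N) hkey
      simp only [smul_mul_assoc, hNN, smul_zero, one_mul] at this
      exact this.symm
    rcases smul_eq_zero.mp h3 with h | h
    · -- `l ^ m = 1`: then `m l^{m-1} ≠ 0` kills `N`
      have hc : ((m : k) * l ^ (m - 1)) ≠ 0 :=
        mul_ne_zero (Nat.cast_ne_zero.mpr hm.ne') (pow_ne_zero _ hl0)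
      have h4 : ((m : k) * l ^ (m - 1)) • N = 0 := by
        rw [hkey, sub_eq_zero.mp h, sub_self, zero_smul]
      exact (smul_eq_zero.mp h4).resolve_left hc
    · exact h
  rw [haN, hN0, add_zero]

/-- **A finite subgroup of `GL_2(k)` (`char k = 0`) with a common eigenvector has cyclic image
in `PGL_2(k)`**: the character `ψ = χ₁² / det` (`χ₁` the eigenvalue on the common eigenline) has
the same kernel as `G → PGL_2(k)` (`GL2.coe_eq_smul_one_of_mulVec_eq_smul`), so the projective
image is a quotient of the finite subgroup `ψ(G) ≤ kˣ`, which is cyclic. [folklore] -/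
theorem isCyclicType_of_hasCommonEigenvector [CharZero k] [Finite G] (ρ : G →* GL (Fin 2) k)
    (h : HasCommonEigenvector ρ) : IsCyclicType ρ := by
  classical
  obtain ⟨v, hv, key⟩ := h
  obtain ⟨i, hi⟩ : ∃ i, v i ≠ 0 := by
    by_contra! hc
    exact hv (funext hc)
  -- the eigenvalue character
  let c : G → k := fun g => (((ρ g : GL (Fin 2) k) : M₂) *ᵥ v) i / v i
  have hc : ∀ g, ((ρ g : GL (Fin 2) k) : M₂) *ᵥ v = c g • v := by
    intro g
    obtain ⟨a, ha⟩ := key g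
    have : c g = a := by
      simp only [c, ha, Pi.smul_apply, smul_eq_mul]
      field_simp
    rw [this, ha]
  have hc0 : ∀ g, c g ≠ 0 := by
    intro g hg
    have h1 := hc g
    rw [hg, zero_smul] at h1
    apply hv
    calc v = (((ρ g)⁻¹ : GL (Fin 2) k) : M₂) *ᵥ (((ρ g : GL (Fin 2) k) : M₂) *ᵥ v) := by
          rw [mulVec_mulVec, ← Matrix.GeneralLinearGroup.coe_mul, inv_mul_cancel,
            Matrix.GeneralLinearGroup.coe_one, one_mulVec]
      _ = 0 := by rw [h1, mulVec_zero]
  have hcmul : ∀ g h, c (g * h) = c g * c h := by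
    intro g h
    have h1 := hc (g * h)
    rw [map_mul, Matrix.GeneralLinearGroup.coe_mul, ← mulVec_mulVec, hc h, mulVec_smul, hc g,
      smul_smul, mul_comm (c h)] at h1
    have h2 : (c (g * h) - c g * c h) • v = 0 := by rw [sub_smul, h1, sub_self]
    exact sub_eq_zero.mp ((smul_eq_zero.mp h2).resolve_right hv)
  let χ : G →* kˣ :=
    { toFun := fun g => Units.mk0 (c g) (hc0 g)
      map_one' := by
        ext
        have h1 := hc 1
        rw [map_one, Matrix.GeneralLinearGroup.coe_one, one_mulVec] at h1
        have h2 : (1 - c 1) • v = 0 := by rw [sub_smul, one_smul, ← h1, sub_self]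
        have := sub_eq_zero.mp ((smul_eq_zero.mp h2).resolve_right hv)
        simp [this.symm]
      map_mul' := fun g h => by ext; simp [hcmul] }
  let ψ : G →* kˣ := χ * χ / (Matrix.GeneralLinearGroup.det.comp ρ)
  -- `ker ψ` maps to `1` in the projective image
  set pr : G →* projectiveImage ρ := (Matrix.ProjGenLinGroup.mk.comp ρ).rangeRestrict with hpr
  have hpr_surj : Function.Surjective pr := MonoidHom.rangeRestrict_surjective _
  have hker : ψ.ker ≤ pr.ker := by
    intro g hg
    rw [MonoidHom.mem_ker] at hg ⊢
    have hg' : c g * c g = ((ρ g : GL (Fin 2) k) : M₂).det := by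
      have := congrArg (fun u : kˣ => (u : k)) hg
      simp only [ψ, χ, MonoidHom.div_apply, MonoidHom.mul_apply, MonoidHom.coe_mk, OneHom.coe_mk,
        MonoidHom.coe_comp, Function.comp_apply, Units.val_div_eq_div_val, Units.val_mul,
        Units.val_mk0, Matrix.GeneralLinearGroup.val_det_apply, Units.val_one] at this
      rw [div_eq_one_iff_eq (GL2.det_ne_zero _)] at this
      exact this
    obtain ⟨m, hm, hgm⟩ := (ρ.isOfFinOrder (isOfFinOrder_of_finite g)).exists_pow_eq_one
    have hscal := GL2.coe_eq_smul_one_of_mulVec_eq_smul hm hgm hv (hc g) hg'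
    apply Subtype.ext
    change Matrix.ProjGenLinGroup.mk (ρ g) = 1
    rw [Matrix.ProjGenLinGroup.mk_eq_one, GL2.mem_center_iff]
    simp [hscal, Matrix.smul_apply]
  -- the projective image is a quotient of the cyclic group `G ⧸ ker ψ ≅ ψ(G) ≤ kˣ`
  haveI : Finite ψ.range := finite_range_of_finite ψ
  haveI : IsCyclic (G ⧸ ψ.ker) :=
    isCyclic_of_surjective (QuotientGroup.quotientKerEquivRange ψ).symm
      (QuotientGroup.quotientKerEquivRange ψ).symm.surjective
  have hlift_surj : Function.Surjective (QuotientGroup.lift ψ.ker pr hker) := by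
    intro x
    obtain ⟨g, rfl⟩ := hpr_surj x
    exact ⟨QuotientGroup.mk g, rfl⟩
  exact isCyclic_of_surjective _ hlift_surj

/-- **Non-cyclic finite projective image ⇒ irreducible** (over a field of characteristic `0`):
a reducible two-dimensional representation with finite image has an invariant line, i.e. a
common eigenvector, hence cyclic projective image. In particular representations of dihedral
(`D_m`, `m ≥ 2`), tetrahedral, octahedral or icosahedral type are irreducible (Tunnell 1981,
p. 173: "the nonmonomial two-dimensional representations are those with image in `PGL(2, ℂ)`
isomorphic to … the tetrahedron, octahedron or icosahedron"). [folklore] -/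
theorem isIrreducible_of_not_isCyclicType [CharZero k] (ρ : G →* GL (Fin 2) k) [Finite ρ.range]
    (h : ¬ IsCyclicType ρ) : (toStdRepresentation ρ).IsIrreducible := by
  classical
  -- reduce to a finite group
  set ι : ρ.range →* GL (Fin 2) k := ρ.range.subtype with hι
  have hPI : projectiveImage ι = projectiveImage ρ := projectiveImage_range_subtype ρ
  have hι' : ¬ IsCyclicType ι := by
    intro hc; apply h; unfold IsCyclicType at hc ⊢; rwa [hPI] at hc
  have hnoev : ¬ HasCommonEigenvector ι := fun hev =>
    hι' (isCyclicType_of_hasCommonEigenvector ι hev)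
  -- a proper non-trivial subrepresentation is a line, giving a common eigenvector
  haveI : Nontrivial (Subrepresentation (toStdRepresentation ρ)) := by
    refine ⟨⟨⊥, ⊤, fun hbt => ?_⟩⟩
    have : (Pi.single 0 1 : Fin 2 → k) ∈ (⊥ : Subrepresentation (toStdRepresentation ρ)) := by
      rw [hbt]; trivial
    have h0 : (Pi.single 0 1 : Fin 2 → k) = 0 := this
    exact one_ne_zero (congrFun h0 0)
  refine ⟨fun W => ?_⟩
  by_contra! hW
  obtain ⟨hWb, hWt⟩ := hW
  apply hnoev
  -- `W` is a line
  have hcoe : (W : Set (Fin 2 → k)) = (W.toSubmodule : Set (Fin 2 → k)) := rfl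
  have hne : W.toSubmodule ≠ ⊤ := fun htop => by
    apply hWt
    apply SetLike.coe_injective
    rw [hcoe, htop]
    rfl
  have hlt : Module.finrank k W.toSubmodule < 2 := by
    have h2 := Submodule.finrank_lt hne
    rwa [Module.finrank_fin_fun] at h2
  have hpos : 0 < Module.finrank k W.toSubmodule := by
    rw [Module.finrank_pos_iff_exists_ne_zero]
    by_contra! hz
    apply hWb
    apply SetLike.coe_injective
    rw [hcoe]
    have hb : W.toSubmodule = ⊥ := by
      rw [Submodule.eq_bot_iff]
      intro x hx
      exact congrArg Subtype.val (hz ⟨x, hx⟩)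
    rw [hb]
    rfl
  have h1 : Module.finrank k W.toSubmodule = 1 := by omega
  obtain ⟨w, hw⟩ := finrank_eq_one_iff'.mp h1
  refine ⟨(w : Fin 2 → k), fun h0 => hw.1 (Subtype.ext h0), ?_⟩
  rintro ⟨_, g, rfl⟩
  change ∃ a : k, ((ρ g : GL (Fin 2) k) : M₂) *ᵥ (w : Fin 2 → k) = a • (w : Fin 2 → k)
  have hmem : ((ρ g : GL (Fin 2) k) : M₂) *ᵥ (w : Fin 2 → k) ∈ W.toSubmodule :=
    W.apply_mem_toSubmodule g w.2
  obtain ⟨a, ha⟩ := hw.2 ⟨_, hmem⟩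
  exact ⟨a, by simpa using congrArg Subtype.val ha.symm⟩

/-- A group isomorphic to a group with two non-commuting elements is not cyclic. [folklore] -/
theorem not_isCyclic_of_mulEquiv_of_ne {P Q : Type*} [Group P] [Group Q] (e : P ≃* Q)
    {a b : Q} (hab : a * b ≠ b * a) : ¬ IsCyclic P := by
  intro hP
  haveI := hP
  haveI : IsCyclic Q := isCyclic_of_surjective e e.surjective
  letI : CommGroup Q := IsCyclic.commGroup
  exact hab (mul_comm a b)

/-- `A_4` has two non-commuting elements. [folklore] -/
theorem exists_mul_ne_alternatingGroup_fin_four :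
    ∃ a b : alternatingGroup (Fin 4), a * b ≠ b * a := by decide

/-- `D_4` has two non-commuting elements. [folklore] -/
theorem exists_mul_ne_dihedralGroup_four :
    ∃ a b : DihedralGroup 4, a * b ≠ b * a :=
  ⟨DihedralGroup.r 1, DihedralGroup.sr 0, by decide⟩

/-- Representations of tetrahedral type are not of cyclic type. [folklore] -/
theorem IsTetrahedralType.not_isCyclicType {n : Type*} [Fintype n] [DecidableEq n] {R : Type*}
    [CommRing R] {ρ : G →* GL n R} (h : IsTetrahedralType ρ) : ¬ IsCyclicType ρ := by
  obtain ⟨e⟩ := h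
  obtain ⟨a, b, hab⟩ := exists_mul_ne_alternatingGroup_fin_four
  exact not_isCyclic_of_mulEquiv_of_ne e hab

/-- A projective image isomorphic to `D_4` is not cyclic. [folklore] -/
theorem not_isCyclicType_of_mulEquiv_dihedralGroup_four {n : Type*} [Fintype n] [DecidableEq n]
    {R : Type*} [CommRing R] {ρ : G →* GL n R} (e : projectiveImage ρ ≃* DihedralGroup 4) :
    ¬ IsCyclicType ρ := by
  obtain ⟨a, b, hab⟩ := exists_mul_ne_dihedralGroup_four
  exact not_isCyclic_of_mulEquiv_of_ne e hab

end IrreducibleOfType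

end Literature.NumberTheory.GaloisRepresentations

namespace Literature.NumberTheory.GaloisRepresentations

/-! ### Restriction to `Γ_E`: primes, inertia and Frobenius elements -/

section FrobeniusRestrict

open NumberField IsDedekindDomain

variable (F E : Type*) [Field F] [NumberField F] [Field E] [NumberField E] [Algebra F E]

omit [NumberField F] [NumberField E] in
/-- The chosen embedding `ι : F̄ → Ē` maps `\bar ℤ_F` (the integral closure of `𝓞 F` in `F̄`)
into `\bar ℤ_E`. [folklore] -/
theorem absClosureEmbedding_mem_absIntegers (x : absIntegers (𝓞 F) F) :
    absClosureEmbedding F E (x : AlgebraicClosure F) ∈ absIntegers (𝓞 E) E := by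
  rw [mem_integralClosure_iff]
  have hx : IsIntegral ℤ (x : AlgebraicClosure F) := isIntegral_trans (R := ℤ) (A := 𝓞 F) _ x.2
  have h1 : IsIntegral ℤ (absClosureEmbedding F E x) :=
    hx.map (absClosureEmbedding F E).toRingHom.toIntAlgHom
  exact h1.tower_top

/-- **Primes, inertia and Frobenius under `Γ_E → Γ_F`.** Let `w` be a finite place of `E` above
the finite place `v` of `F` and `𝔔` a prime of `\bar ℤ_E` above `w`. There is a prime `𝔓` of
`\bar ℤ_F` above `v` (namely `ι⁻¹(𝔔)`) such that the restriction `res : Γ_E → Γ_F` maps the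
inertia group `I_𝔔` into `I_𝔓`, and maps any arithmetic Frobenius `τ` at `𝔔` to
`Frob_𝔓^{f(w|v)}` modulo `I_𝔓`: `res(τ) · (φ^{f})⁻¹ ∈ I_𝔓` for every arithmetic Frobenius `φ`
at `𝔓`, `f = f(w|v)` the residue degree (`N w = (N v)^f`).
Ref: Neukirch, *Algebraic Number Theory*, Ch. I §9, (9.4)–(9.5); Serre, *Local Fields*, I §8.
[folklore] -/
theorem exists_primesAbove_restrict {v : HeightOneSpectrum (𝓞 F)} {w : HeightOneSpectrum (𝓞 E)}
    (hw : w.asIdeal.under (𝓞 F) = v.asIdeal) {𝔔 : Ideal (absIntegers (𝓞 E) E)}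
    (h𝔔 : 𝔔 ∈ w.primesAbove) :
    ∃ 𝔓 ∈ v.primesAbove,
      (∀ γ ∈ 𝔔.inertia (absoluteGaloisGroup E),
        absGaloisRestrict F E γ ∈ 𝔓.inertia (absoluteGaloisGroup F)) ∧
      ∀ τ : absoluteGaloisGroup E, IsArithFrobAt (𝓞 E) τ 𝔔 →
        ∀ φ : absoluteGaloisGroup F, IsArithFrobAt (𝓞 F) φ 𝔓 →
          absGaloisRestrict F E τ * (φ ^ (w.asIdeal.inertiaDeg (𝓞 F)))⁻¹ ∈
            𝔓.inertia (absoluteGaloisGroup F) := by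
  classical
  -- the map `ιₒ : \bar ℤ_F → \bar ℤ_E`
  let ιo : absIntegers (𝓞 F) F →+* absIntegers (𝓞 E) E :=
    ((absClosureEmbedding F E).toRingHom.comp (absIntegers (𝓞 F) F).val.toRingHom).codRestrict
      (absIntegers (𝓞 E) E) (fun x => absClosureEmbedding_mem_absIntegers F E x)
  have hιo : ∀ x : absIntegers (𝓞 F) F,
      ((ιo x : absIntegers (𝓞 E) E) : AlgebraicClosure E) = absClosureEmbedding F E x :=
    fun _ => rfl
  have hιo_inj : Function.Injective ιo := fun x y h => by
    apply Subtype.ext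
    apply (absClosureEmbedding F E).toRingHom.injective
    exact congrArg Subtype.val h
  have hιo_smul : ∀ (γ : absoluteGaloisGroup E) (x : absIntegers (𝓞 F) F),
      ιo (absGaloisRestrict F E γ • x) = γ • ιo x := fun γ x => by
    apply Subtype.ext
    rw [hιo]
    change absClosureEmbedding F E (absGaloisRestrict F E γ • (x : AlgebraicClosure F)) =
      γ • absClosureEmbedding F E x
    exact absGaloisRestrict_apply_smul F E γ x
  -- compatibility with the structure maps
  have hιo_alg : ιo.comp (algebraMap (𝓞 F) (absIntegers (𝓞 F) F)) =
      (algebraMap (𝓞 E) (absIntegers (𝓞 E) E)).comp (algebraMap (𝓞 F) (𝓞 E)) := by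
    ext r
    change absClosureEmbedding F E (algebraMap (𝓞 F) (AlgebraicClosure F) r) =
      algebraMap (𝓞 E) (AlgebraicClosure E) (algebraMap (𝓞 F) (𝓞 E) r)
    rw [IsScalarTower.algebraMap_apply (𝓞 F) F (AlgebraicClosure F), AlgHom.commutes,
      IsScalarTower.algebraMap_apply (𝓞 E) E (AlgebraicClosure E),
      ← IsScalarTower.algebraMap_apply (𝓞 F) (𝓞 E) E, IsScalarTower.algebraMap_apply (𝓞 F) F E,
      ← IsScalarTower.algebraMap_apply F E (AlgebraicClosure E)]
  -- the prime `𝔓 = ιₒ⁻¹(𝔔)`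
  set 𝔓 : Ideal (absIntegers (𝓞 F) F) := 𝔔.comap ιo with h𝔓def
  haveI : 𝔔.IsPrime := h𝔔.1
  haveI : 𝔔.LiesOver w.asIdeal := h𝔔.2
  have h𝔓prime : 𝔓.IsPrime := Ideal.comap_isPrime ιo 𝔔
  have h𝔓over : 𝔓.LiesOver v.asIdeal := by
    constructor
    rw [← hw]
    change _ = Ideal.comap (algebraMap (𝓞 F) (absIntegers (𝓞 F) F)) (Ideal.comap ιo 𝔔)
    rw [Ideal.comap_comap, hιo_alg, ← Ideal.comap_comap]
    change Ideal.comap (algebraMap (𝓞 F) (𝓞 E)) (w.asIdeal) =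
      Ideal.comap (algebraMap (𝓞 F) (𝓞 E)) (𝔔.under (𝓞 E))
    rw [← Ideal.LiesOver.over (P := 𝔔) (p := w.asIdeal)]
  have h𝔓 : 𝔓 ∈ v.primesAbove := ⟨h𝔓prime, h𝔓over⟩
  refine ⟨𝔓, h𝔓, fun γ hγ x => ?_, fun τ hτ φ hφ => ?_⟩
  · -- inertia
    change absGaloisRestrict F E γ • x - x ∈ Ideal.comap ιo 𝔔
    rw [Ideal.mem_comap, map_sub, hιo_smul]
    exact hγ (ιo x)
  · -- Frobenius: `res τ • x ≡ x ^ (N w)` and `φ ^ f • x ≡ x ^ ((N v) ^ f)` modulo `𝔓`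
    have hqw : w.residueCard = v.residueCard ^ (w.asIdeal.inertiaDeg (𝓞 F)) := by
      haveI : w.asIdeal.LiesOver v.asIdeal := ⟨hw.symm⟩
      haveI : v.asIdeal.IsMaximal := v.isPrime.isMaximal v.ne_bot
      haveI : w.asIdeal.IsMaximal := w.isPrime.isMaximal w.ne_bot
      rw [HeightOneSpectrum.residueCard, HeightOneSpectrum.residueCard,
        Ideal.absNorm_eq_pow_inertiaDeg'_of_liesOver w.asIdeal v.asIdeal v.isPrime v.ne_bot,
        Ideal.inertiaDeg'_eq_inertiaDeg v.asIdeal w.asIdeal]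
    have hτ' : ∀ x : absIntegers (𝓞 F) F,
        absGaloisRestrict F E τ • x - x ^ w.residueCard ∈ 𝔓 := fun x => by
      rw [h𝔓def, Ideal.mem_comap, map_sub, map_pow, hιo_smul]
      exact (HeightOneSpectrum.isArithFrobAt_iff_of_mem_primesAbove h𝔔 τ).mp hτ (ιo x)
    have hφ' := (HeightOneSpectrum.isArithFrobAt_iff_of_mem_primesAbove h𝔓 φ).mp hφ
    -- powers of Frobenius
    have hφpow : ∀ (k : ℕ) (x : absIntegers (𝓞 F) F),
        φ ^ k • x - x ^ (v.residueCard ^ k) ∈ 𝔓 := by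
      intro k
      induction k with
      | zero => intro x; simp
      | succ k ih =>
        intro x
        rw [pow_succ', mul_smul, pow_succ, pow_mul]
        have h1 := hφ' (φ ^ k • x)
        have h2 : (φ ^ k • x) ^ v.residueCard - (x ^ v.residueCard ^ k) ^ v.residueCard ∈ 𝔓 := by
          rw [← Ideal.Quotient.eq_zero_iff_mem, map_sub, map_pow, map_pow, sub_eq_zero]
          congr 1
          rw [← sub_eq_zero, ← map_sub, Ideal.Quotient.eq_zero_iff_mem]
          exact ih x
        have := add_mem h1 h2
        rwa [sub_add_sub_cancel] at this
    intro x
    change (absGaloisRestrict F E τ * (φ ^ (w.asIdeal.inertiaDeg (𝓞 F)))⁻¹) • x - x ∈ 𝔓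
    set y := (φ ^ (w.asIdeal.inertiaDeg (𝓞 F)))⁻¹ • x with hy
    have hx : x = φ ^ (w.asIdeal.inertiaDeg (𝓞 F)) • y := by rw [hy, smul_inv_smul]
    have h3 := hτ' y
    have h4 := hφpow (w.asIdeal.inertiaDeg (𝓞 F)) y
    rw [← hqw, ← hx] at h4
    rw [mul_smul, ← hy]
    have := sub_mem h3 h4
    rwa [sub_sub_sub_cancel_right] at this

variable {F E}
variable {A : Type*} [CommRing A] [TopologicalSpace A] {n : ℕ}

/-- **Restriction preserves unramifiedness**: if `σ : Γ_F → GL_n(A)` is unramified at `v`, then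
`σ|_{Γ_E}` is unramified at every place `w` of `E` above `v` (inertia at `𝔔 ∣ w` restricts into
inertia at `ι⁻¹(𝔔) ∣ v`). Serre, *Abelian ℓ-adic representations* (1968), Ch. I §2.1. [folklore] -/
theorem FramedGaloisRep.isUnramifiedAt_restrictField (σ : FramedGaloisRep F A n)
    {v : HeightOneSpectrum (𝓞 F)} {w : HeightOneSpectrum (𝓞 E)}
    (hw : w.asIdeal.under (𝓞 F) = v.asIdeal) (hσ : σ.IsUnramifiedAt v) :
    (σ.restrictField E).IsUnramifiedAt w := by
  intro 𝔔 h𝔔 γ hγ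
  obtain ⟨𝔓, h𝔓, hI, -⟩ := exists_primesAbove_restrict F E hw h𝔔
  rw [FramedGaloisRep.restrictField_apply]
  exact hσ 𝔓 h𝔓 _ (hI γ hγ)

/-- **Frobenius of the restriction is a power of Frobenius**: if `σ` is unramified at `v` and
`τ ∈ Γ_E` is an arithmetic Frobenius at a prime `𝔔 ∣ w`, `w ∣ v`, then
`σ|_{Γ_E}(τ) = σ(φ)^{f(w|v)}` for an arithmetic Frobenius `φ ∈ Γ_F` at the prime `ι⁻¹(𝔔) ∣ v`.
Neukirch, *Algebraic Number Theory*, Ch. I §9; Serre 1968, Ch. I §2.1. [folklore] -/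
theorem FramedGaloisRep.exists_restrictField_apply_eq_pow (σ : FramedGaloisRep F A n)
    {v : HeightOneSpectrum (𝓞 F)} {w : HeightOneSpectrum (𝓞 E)}
    (hw : w.asIdeal.under (𝓞 F) = v.asIdeal) (hσ : σ.IsUnramifiedAt v)
    {𝔔 : Ideal (absIntegers (𝓞 E) E)} (h𝔔 : 𝔔 ∈ w.primesAbove) {τ : absoluteGaloisGroup E}
    (hτ : IsArithFrobAt (𝓞 E) τ 𝔔) :
    ∃ 𝔓 ∈ v.primesAbove, ∃ φ : absoluteGaloisGroup F, IsArithFrobAt (𝓞 F) φ 𝔓 ∧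
      (σ.restrictField E) τ = σ φ ^ (w.asIdeal.inertiaDeg (𝓞 F)) := by
  obtain ⟨𝔓, h𝔓, -, hFr⟩ := exists_primesAbove_restrict F E hw h𝔔
  obtain ⟨φ, hφ⟩ := HeightOneSpectrum.exists_isArithFrobAt_of_mem_primesAbove_holds h𝔓
  refine ⟨𝔓, h𝔓, φ, hφ, ?_⟩
  have h1 := hσ 𝔓 h𝔓 _ (hFr τ hτ φ hφ)
  rw [map_mul, map_inv, mul_inv_eq_one] at h1
  rw [FramedGaloisRep.restrictField_apply, h1, map_pow]

/-- `2 × 2` matrices: if `charpoly M = (X - a)(X - b)` then `charpoly (M^f) = (X - a^f)(X - b^f)`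
(Newton's recursion for `tr M^f` from Cayley–Hamilton, and `det M^f = (det M)^f`). [folklore] -/
theorem Matrix.charpoly_pow_eq_of_charpoly_eq_fin_two {k : Type*} [Field k]
    (M : Matrix (Fin 2) (Fin 2) k) {a b : k}
    (h : M.charpoly = (Polynomial.X - Polynomial.C a) * (Polynomial.X - Polynomial.C b)) (f : ℕ) :
    (M ^ f).charpoly =
      (Polynomial.X - Polynomial.C (a ^ f)) * (Polynomial.X - Polynomial.C (b ^ f)) := by
  open Polynomial in
  have h' : (X ^ 2 - C M.trace * X + C M.det : k[X]) = X ^ 2 - C (a + b) * X + C (a * b) := by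
    rw [← Matrix.charpoly_fin_two, h, map_add, map_mul]; ring
  have hdet : M.det = a * b := by
    have h0 := congrArg (fun p : k[X] => p.coeff 0) h'
    simpa using h0
  have htr : M.trace = a + b := by
    have h1 := congrArg (fun p : k[X] => p.coeff 1) h'
    have h1' : -M.trace = -b + -a := by simpa using h1
    linear_combination -h1'
  have hCH : M * M = (a + b) • M - (a * b) • (1 : Matrix (Fin 2) (Fin 2) k) := by
    rw [GL2.cayley_hamilton_two, htr, hdet]
  -- Newton: `tr M^f = a^f + b^f`
  have htrpow : ∀ f : ℕ, (M ^ f).trace = a ^ f + b ^ f ∧ (M ^ (f + 1)).trace =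
      a ^ (f + 1) + b ^ (f + 1) := by
    intro f
    induction f with
    | zero =>
      refine ⟨?_, ?_⟩
      · rw [pow_zero, Matrix.trace_one, Fintype.card_fin]; norm_num
      · rw [zero_add, pow_one, htr, pow_one, pow_one]
    | succ f ih =>
      refine ⟨ih.2, ?_⟩
      rw [pow_succ, pow_succ, mul_assoc, hCH, mul_sub, Matrix.trace_sub, mul_smul_comm,
        mul_smul_comm, Matrix.trace_smul, Matrix.trace_smul, mul_one, ← pow_succ, ih.2, ih.1,
        smul_eq_mul, smul_eq_mul]
      ring
  rw [Matrix.charpoly_fin_two, (htrpow f).1, Matrix.det_pow, hdet, map_add, map_pow, map_pow,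
    map_pow, map_mul]
  ring

/-- **Frobenius characteristic polynomials under restriction (rank `2`)**: if
`σ : Γ_F → GL_2(k)` is unramified at `v` with `charpoly σ(Frob_v) = (X - a)(X - b)`, then for
every place `w ∣ v` of `E`, `charpoly σ|_{Γ_E}(Frob_w) = (X - a^{f(w|v)})(X - b^{f(w|v)})`
(`Frob_w ↦ Frob_v^{f(w|v)}` modulo inertia). This is the Galois-side counterpart of the base
change relation `t_{Π_w} = t_{π_v}^{f(w|v)}` (Arthur–Clozel 1989, Ch. 3, (1.1); Gelbart 1997,
p. 249). Neukirch, *Algebraic Number Theory*, Ch. I §9; Serre 1968, Ch. I §2.1. [folklore] -/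
theorem FramedGaloisRep.hasFrobCharpolyAt_restrictField_fin_two {k : Type*} [Field k]
    [TopologicalSpace k] (σ : FramedGaloisRep F k 2)
    {v : HeightOneSpectrum (𝓞 F)} {w : HeightOneSpectrum (𝓞 E)}
    (hw : w.asIdeal.under (𝓞 F) = v.asIdeal) (hσ : σ.IsUnramifiedAt v) {a b : k}
    (hP : σ.HasFrobCharpolyAt v ((Polynomial.X - Polynomial.C a) * (Polynomial.X - Polynomial.C b))) :
    (σ.restrictField E).HasFrobCharpolyAt w
      ((Polynomial.X - Polynomial.C (a ^ w.asIdeal.inertiaDeg (𝓞 F))) *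
        (Polynomial.X - Polynomial.C (b ^ w.asIdeal.inertiaDeg (𝓞 F)))) := by
  intro 𝔔 h𝔔 τ hτ
  obtain ⟨𝔓, h𝔓, φ, hφ, heq⟩ := σ.exists_restrictField_apply_eq_pow hw hσ h𝔔 hτ
  have hch : FramedRep.charpoly σ φ = (Polynomial.X - Polynomial.C a) *
      (Polynomial.X - Polynomial.C b) := hP 𝔓 h𝔓 φ hφ
  unfold FramedRep.charpoly at hch ⊢
  rw [heq, Units.val_pow_eq_pow_val]
  exact Matrix.charpoly_pow_eq_of_charpoly_eq_fin_two _ hch _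

end FrobeniusRestrict

/-! ### Artin representations are unramified almost everywhere -/

section UnramifiedAE

open NumberField IsDedekindDomain

variable {F : Type*} [Field F] [NumberField F] {A : Type*} [CommRing A] [TopologicalSpace A]
  {n : ℕ}

/-- **A Galois representation with open kernel is unramified at all but finitely many places.**
If `σ : Γ_F → GL_n(A)` has open kernel `N` (e.g. `σ` continuous with finite image), let
`L = F̄^N`, a finite Galois extension of `F`; at a finite place `v` of `F` unramified in `L`
(all but the finitely many `v` below a prime dividing the different `𝔇_{L/F}`), every inertia
group `I_𝔓 ≤ Γ_F`, `𝔓 ∣ v`, restricts into the inertia group of `𝔓 ∩ 𝓞 L` in `Gal(L/F)`, which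
is trivial (`#I = e = 1`), so `I_𝔓 ≤ Gal(F̄/L) = N` and `σ(I_𝔓) = 1`.
Serre, *Abelian ℓ-adic representations* (1968), Ch. I §2.1 (an Artin representation is
unramified outside a finite set); Neukirch, *Algebraic Number Theory*, Ch. III §2, Thm. (2.6)
(primes ramified in `L/F` divide the different). [folklore] -/
theorem FramedGaloisRep.eventually_isUnramifiedAt_of_isOpen_ker (σ : FramedGaloisRep F A n)
    (hker : IsOpen (σ.toMonoidHom.ker : Set (absoluteGaloisGroup F))) :
    ∀ᶠ v in Filter.cofinite, σ.IsUnramifiedAt v := by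
  classical
  set N : Subgroup (absoluteGaloisGroup F) := σ.toMonoidHom.ker with hNdef
  set L : IntermediateField F (AlgebraicClosure F) := IntermediateField.fixedField N with hLdef
  have hLN : L.fixingSubgroup = N := fixingSubgroup_fixedField_of_isOpen N hker
  haveI : FiniteDimensional F L := finiteDimensional_fixedField_of_isOpen N hker
  haveI : IsGalois F L := by
    rw [← InfiniteGalois.normal_iff_isGalois, hLN, hNdef]
    exact MonoidHom.normal_ker _
  haveI : NumberField L := NumberField.of_module_finite F L
  haveI : Module.Finite (𝓞 F) (𝓞 L) := IsIntegralClosure.finite (𝓞 F) F L (𝓞 L)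
  haveI : IsGaloisGroup (L ≃ₐ[F] L) (𝓞 F) (𝓞 L) :=
    IsGaloisGroup.of_isFractionRing (L ≃ₐ[F] L) (𝓞 F) (𝓞 L) F L
  set G := L ≃ₐ[F] L
  -- the different and the finitely many places below its prime factors
  have hD : differentIdeal (𝓞 F) (𝓞 L) ≠ ⊥ := differentIdeal_ne_bot
  set bad : Set (HeightOneSpectrum (𝓞 F)) :=
    {v | ∃ P : HeightOneSpectrum (𝓞 L), P.asIdeal ∣ differentIdeal (𝓞 F) (𝓞 L) ∧
      P.asIdeal.under (𝓞 F) = v.asIdeal} with hbad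
  have hbadfin : bad.Finite := by
    have h1 : (((fun P : HeightOneSpectrum (𝓞 L) => P.asIdeal.under (𝓞 F)) ''
        {P | P.asIdeal ∣ differentIdeal (𝓞 F) (𝓞 L)})).Finite :=
      (Ideal.finite_factors hD).image _
    refine (h1.preimage (f := fun v : HeightOneSpectrum (𝓞 F) => v.asIdeal) ?_).subset ?_
    · exact fun v _ w _ h => HeightOneSpectrum.ext h
    · rintro v ⟨P, hP, hPv⟩
      exact ⟨P, hP, hPv⟩
  rw [Filter.eventually_iff_exists_mem]
  refine ⟨badᶜ, hbadfin.compl_mem_cofinite, fun v hv => ?_⟩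
  intro 𝔓 h𝔓 g hg
  haveI : 𝔓.IsPrime := h𝔓.1
  haveI : 𝔓.LiesOver v.asIdeal := h𝔓.2
  haveI : v.asIdeal.IsPrime := v.isPrime
  -- the prime `P = 𝔓 ∩ 𝓞 L` of `𝓞 L` below `𝔓`
  set ι := EllipticCurves.ringOfIntegersToIntegralClosure (k := F) (Ω := AlgebraicClosure F) L with hιdef
  set P : Ideal (𝓞 L) := 𝔓.comap ι with hPdef
  haveI hPprime : P.IsPrime := Ideal.comap_isPrime ι 𝔓
  have hιalg : ∀ r : 𝓞 F, ι (algebraMap (𝓞 F) (𝓞 L) r) =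
      algebraMap (𝓞 F) (absIntegers (𝓞 F) F) r := fun r => rfl
  haveI hPover : P.LiesOver v.asIdeal := by
    constructor
    ext r
    rw [h𝔓.2.over, Ideal.under, Ideal.under, Ideal.mem_comap, Ideal.mem_comap, hPdef,
      Ideal.mem_comap]
    exact (Iff.of_eq (congrArg (· ∈ 𝔓) (hιalg r))).symm
  have hPne : P ≠ ⊥ := Ideal.ne_bot_of_liesOver_of_ne_bot v.ne_bot P
  -- `e(P | v) = 1`, since `P` does not divide the different (`v ∉ bad`)
  have hndvd : ¬ P ∣ differentIdeal (𝓞 F) (𝓞 L) := fun h =>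
    hv ⟨⟨P, hPprime, hPne⟩, h, (Ideal.LiesOver.over (P := P) (p := v.asIdeal)).symm⟩
  have he : Ideal.ramificationIdx' v.asIdeal P = 1 := by
    set e := Ideal.ramificationIdx' v.asIdeal P with hedef
    have hne : e ≠ 0 := Ideal.IsDedekindDomain.ramificationIdx'_ne_zero_of_liesOver P v.ne_bot
    have hdvd : P ^ (e - 1) ∣ differentIdeal (𝓞 F) (𝓞 L) :=
      pow_sub_one_dvd_differentIdeal (𝓞 F) P e v.ne_bot
        (Ideal.dvd_iff_le.mpr (Ideal.le_pow_ramificationIdx'))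
    by_contra h1
    exact hndvd ((dvd_pow_self P (by omega : e - 1 ≠ 0)).trans hdvd)
  -- hence the inertia group of `P` in `Gal(L/F)` is trivial
  have hinertia : P.inertia G = ⊥ := by
    apply Subgroup.eq_bot_of_card_eq
    rw [Ideal.card_inertia_eq_ramificationIdxIn (G := G) v.asIdeal P,
      Ideal.ramificationIdxIn_eq_ramificationIdx v.asIdeal P G,
      ← Ideal.ramificationIdx'_eq_ramificationIdx v.asIdeal P v.ne_bot, he]
  -- restrict `g` to `L`: it lies in the inertia group of `P`, hence is trivial
  set gbar : G := AlgEquiv.restrictNormalHom L (absoluteGaloisGroup.toAlgEquiv F g) with hgbar_def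
  have hgbar : ∀ x : L, ((gbar x : L) : AlgebraicClosure F) = g • (x : AlgebraicClosure F) :=
    fun x => AlgEquiv.restrictNormalHom_apply L _ x
  have hmem : gbar ∈ P.inertia G := by
    intro y
    change gbar • y - y ∈ Ideal.comap ι 𝔓
    rw [Ideal.mem_comap]
    have h1 : ι (gbar • y) = g • ι y := by
      apply Subtype.ext
      rw [integralClosure.coe_smul, EllipticCurves.coe_ringOfIntegersToIntegralClosure,
        EllipticCurves.coe_ringOfIntegersToIntegralClosure]
      exact hgbar y
    have hsub : ι (gbar • y - y) = g • ι y - ι y := (map_sub ι _ _).trans (by rw [h1])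
    exact hsub ▸ hg (ι y)
  rw [hinertia, Subgroup.mem_bot] at hmem
  -- so `g` fixes `L` pointwise, i.e. `g ∈ N = ker σ`
  have hgL : g ∈ (L.fixingSubgroup : Subgroup (absoluteGaloisGroup F)) :=
    (mem_fixingSubgroup_iff_forall_smul L g).mpr fun x => by rw [← hgbar x, hmem]; rfl
  rw [hLN, hNdef] at hgL
  exact hgL

end UnramifiedAE

end Literature.NumberTheory.GaloisRepresentations
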